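import Summits.MatrixMultiplication.MatrixMultiplication.Theorems.FarEdgeDescentTwistRigidityCore
import HarnessLib

/-!
# Far-edge descent — twist rigidity: `⟨n,n,2L⟩^{⊠N} ⊵ 𝔖_φ^{⊠N}` iff `φ` is a product permutation

Support file for route `FarEdgeDescent` (aside `SubLogRate`), kernel VI of the lineage
`decomp-mm-lens-2` («structural dichotomy, special vs generic»); cut of record (rev 13)
`FiniteSaturation ∧ AnchoredLogConvexity → MatrixMultiplication` UNCHANGED.

**Object.** For a permutation `φ` of the index grid `Fin n × Fin n`, the **`φ`-twisted star**
`𝔖_φ` is the `x`-shared tensor of `(X, (Y, Y')) ↦ (XY, φ(X)Y')`, `φ(X)_{φ b} = X_b` (`permStar`);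
`φ = ᵀ` (`Equiv.prodComm`) gives the twisted star `𝔖_n(L)` of Kernels I–V (`permStar_prodComm`).

**Dichotomy (special vs generic), every finite level.**  For every field, `L ≥ 1`, `N ≥ 1`,
every `φ` (`matMul_pow_algDegeneratesTo_permStar_pow_iff`):
`⟨n,n,2L⟩^{⊠N} ⊵ 𝔖_φ^{⊠N} ⟺ φ` is a **product permutation** `(i, j) ↦ (σ i, τ j)`.
* SPECIAL (the `(n!)²` product permutations): `𝔖_φ` IS `⟨n,n,2L⟩` relabelled — mutual restriction
  (`matMul_restrictsTo_permStar`, `permStar_restrictsTo_matMul`).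
* GENERIC (every other `φ`; for `n = 2`: `20` of the `24`, among them `ᵀ`): `𝔖_φ^{⊠N}` is NOT a
  degeneration of `⟨n,n,2L⟩^{⊠N}` for any `N ≥ 1` (`matMul_pow_not_algDegeneratesTo_permStar_pow`);
  Kernel IV (`φ = ᵀ`) is the first instance, and the anti-homomorphism `X ↦ Xᵀ` plays no role
  (no `commutant_fst_eq_snd`): only that `ᵀ` moves some row off the rows.

**Proof.** Commutant obstruction (`FarEdgeDescentCommutantObstruction`, BCS (15.19)) with the
`(2L)^{2N}` column-unit operators of Kernel IV on the coherent side; on the `𝔖_φ` side the transfer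
identities of `FarEdgeDescentTwistRigidityCore` kill every entry of an intertwining pair `(β, γ')`
at leaf indices whose tags lie on different SIDES at some position (relative twist `φ^{±1}`, not a
product permutation), and on same-side pairs `β = γ'` is a function of (tags, columns, columns):
dimension `≤ 2^N L^{2N} < (2L)^{2N}`.

**Exhaustion of the lens.**  Product permutations are exactly the twists invisible to the coherent
star; every other twist is rigidly NOT below it.  The CASHING direction `𝔖_φ^{⊠N} ⊵ ⟨…⟩` (what
transpose cashing / `LittleCw*` needs asymptotically) is known to be obstructed only for the double
coset `(σ × τ) ∘ ᵀ` (alternating self-pairing, Kernel II); for the other generic twists it is OPEN.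

[cite: BurgisserClausenShokrollahi1997, (15.19)–(15.25); Strassen1988, §3; Blaser2013, §5]
-/

noncomputable section

set_option linter.dupNamespace false

namespace Summit.MatrixMultiplication.MatrixMultiplication.Theorems.FarEdgeDescentTwistRigidity

open Literature.Computability.AlgebraicComplexity
open Summit.MatrixMultiplication.MatrixMultiplication.Theorems.FarEdgeDescentCommutantObstruction
open Summit.MatrixMultiplication.MatrixMultiplication.Theorems.FarEdgeDescentConverseRigidity
open Summit.MatrixMultiplication.MatrixMultiplication.Theorems.FarEdgeDescentTwistedStar

/-! ## The twist assignment of `𝔖_φ` and its relative twists -/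

section TagTwist

variable {n L : ℕ}

/-- The twist assignment of `𝔖_φ` on the leaf tags `Fin L ⊕ Fin L`: identity on the `inl` (coherent)
leaf columns, `φ` on the `inr` (twisted) ones. [folklore] -/
def tagTwist (φ : Equiv.Perm (Fin n × Fin n)) (s : Fin L ⊕ Fin L) : Equiv.Perm (Fin n × Fin n) :=
  Sum.elim (fun _ => Equiv.refl _) (fun _ => φ) s

/-- Same-side leaf tags have trivial relative twist. [folklore] -/
theorem rel_tagTwist_same (φ : Equiv.Perm (Fin n × Fin n)) {s s' : Fin L ⊕ Fin L}
    (h : s.isLeft = s'.isLeft) (x : Fin n × Fin n) : rel (tagTwist φ) s s' x = x := by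
  cases s <;> cases s' <;> simp_all [tagTwist]

/-- The relative twist `inr / inl` is `φ`. [folklore] -/
theorem rel_tagTwist_inr_inl (φ : Equiv.Perm (Fin n × Fin n)) (l l' : Fin L) :
    rel (tagTwist (L := L) φ) (Sum.inr l) (Sum.inl l') = φ :=
  Equiv.ext fun x => by simp [tagTwist]

/-- The relative twist `inl / inr` is `φ⁻¹`. [folklore] -/
theorem rel_tagTwist_inl_inr (φ : Equiv.Perm (Fin n × Fin n)) (l l' : Fin L) :
    rel (tagTwist (L := L) φ) (Sum.inl l) (Sum.inr l') = φ.symm :=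
  Equiv.ext fun x => by simp [tagTwist]

/-- Different-side leaf tags have relative twist `φ^{±1}`, which is not a product permutation when
`φ` is not. [folklore] -/
theorem not_isProdPerm_rel_tagTwist {φ : Equiv.Perm (Fin n × Fin n)} (hφ : ¬ IsProdPerm φ)
    {s s' : Fin L ⊕ Fin L} (h : s.isLeft ≠ s'.isLeft) : ¬ IsProdPerm (rel (tagTwist φ) s s') := by
  rcases s with l | l <;> rcases s' with l' | l'
  · exact absurd rfl h
  · rw [rel_tagTwist_inl_inr]
    exact fun h' => hφ (by simpa using h'.symm)
  · rw [rel_tagTwist_inr_inl]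
    exact hφ
  · exact absurd rfl h

/-- On a grid with at most one point every permutation is a product permutation; so a non-product
twist forces `2 ≤ n`. [folklore] -/
theorem two_le_of_not_isProdPerm {φ : Equiv.Perm (Fin n × Fin n)} (hφ : ¬ IsProdPerm φ) : 2 ≤ n := by
  by_contra hn
  refine hφ ⟨id, id, fun b => Prod.ext (Fin.ext ?_) (Fin.ext ?_)⟩
  · have h₁ := (φ b).1.isLt; have h₂ := b.1.isLt; simp only [id]; omega
  · have h₁ := (φ b).2.isLt; have h₂ := b.2.isLt; simp only [id]; omega

end TagTwist

/-! ## The commutant of `𝔖_φ^{⊠N}` for a non-product twist is small -/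

section Commutant

variable {K : Type*} [Field K] {n L N : ℕ}

/-- **Entries of an intertwining pair of `𝔖_φ^{⊠N}`, `φ` not a product permutation.**  Both `β`
and `γ'` vanish at `(u, z)` unless `u`, `z` have the same row and the same side in every position,
and then both equal `β (base u) (base z)`. [folklore] -/
theorem perm_entry (hn : 2 ≤ n) {φ : Equiv.Perm (Fin n × Fin n)} (hφ : ¬ IsProdPerm φ)
    (β γ' : Matrix (Fin N → Fin n × (Fin L ⊕ Fin L)) (Fin N → Fin n × (Fin L ⊕ Fin L)) K)
    (h : ∀ b, β * slice (kroneckerPow (routed (R := K) (trow (tagTwist φ)) (tcol (tagTwist φ))) N) b =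
      slice (kroneckerPow (routed (R := K) (trow (tagTwist φ)) (tcol (tagTwist φ))) N) b * γ')
    (u z : Fin N → Fin n × (Fin L ⊕ Fin L)) :
    β u z = (if ∀ i, (u i).1 = (z i).1 ∧ (u i).2.isLeft = (z i).2.isLeft
      then β (base hn u) (base hn z) else 0) ∧
    γ' u z = (if ∀ i, (u i).1 = (z i).1 ∧ (u i).2.isLeft = (z i).2.isLeft
      then β (base hn u) (base hn z) else 0) := by
  by_cases hside : ∀ i, (u i).2.isLeft = (z i).2.isLeft
  · -- same sides everywhere: both transfers are with the identity twist
    have tβ : ∀ u z : Fin N → Fin n × (Fin L ⊕ Fin L), (∀ i, (u i).2.isLeft = (z i).2.isLeft) →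
        β u z = if ∀ i, (u i).1 = (z i).1 then γ' (base hn u) (base hn z) else 0 := by
      intro u z hs
      rw [transfer_fst (tagTwist φ) β γ' h u z (fun _ => ⟨0, by omega⟩)]
      simp only [rel_tagTwist_same φ (hs _)]
      rfl
    have tγ : ∀ u z : Fin N → Fin n × (Fin L ⊕ Fin L), (∀ i, (u i).2.isLeft = (z i).2.isLeft) →
        γ' u z = if ∀ i, (u i).1 = (z i).1 then β (base hn u) (base hn z) else 0 := by
      intro u z hs
      rw [transfer_snd (tagTwist φ) β γ' h u z (fun _ => ⟨0, by omega⟩)]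
      have hs' : ∀ i, (z i).2.isLeft = (u i).2.isLeft := fun i => (hs i).symm
      simp only [rel_tagTwist_same φ (hs' _)]
      rfl
    have hbs : ∀ i, (base hn u i).2.isLeft = (base hn z i).2.isLeft := fun i => hside i
    have hbr : ∀ i, (base hn u i).1 = (base hn z i).1 := fun _ => rfl
    have eγ : γ' (base hn u) (base hn z) = β (base hn u) (base hn z) := by
      rw [tγ _ _ hbs, if_pos hbr]; rfl
    by_cases hr : ∀ i, (u i).1 = (z i).1
    · have hc : ∀ i, (u i).1 = (z i).1 ∧ (u i).2.isLeft = (z i).2.isLeft := fun i => ⟨hr i, hside i⟩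
      rw [if_pos hc, tβ u z hside, if_pos hr, tγ u z hside, if_pos hr, eγ]
      exact ⟨rfl, rfl⟩
    · have hc : ¬ ∀ i, (u i).1 = (z i).1 ∧ (u i).2.isLeft = (z i).2.isLeft :=
        fun h' => hr fun i => (h' i).1
      rw [if_neg hc, tβ u z hside, if_neg hr, tγ u z hside, if_neg hr]
      exact ⟨rfl, rfl⟩
  · -- some position with different sides: relative twist `φ^{±1}`, both entries vanish
    obtain ⟨i₀, hi₀⟩ := not_forall.mp hside
    have hc : ¬ ∀ i, (u i).1 = (z i).1 ∧ (u i).2.isLeft = (z i).2.isLeft := fun h' => hi₀ (h' i₀).2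
    rw [if_neg hc]
    exact ⟨fst_eq_zero_of_not_isProdPerm _ β γ' h u z i₀ (not_isProdPerm_rel_tagTwist hφ hi₀),
      snd_eq_zero_of_not_isProdPerm _ β γ' h u z i₀ (not_isProdPerm_rel_tagTwist hφ hi₀)⟩

/-- **Every intertwining pair of `𝔖_φ^{⊠N}` (`φ` not a product permutation) lies in the image of
`(paramMap, paramMap)` restricted to the diagonal**: dimension `≤ 2^N · L^N · L^N`. [folklore] -/
theorem perm_mem_range (hn : 2 ≤ n) {φ : Equiv.Perm (Fin n × Fin n)} (hφ : ¬ IsProdPerm φ)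
    (β γ' : Matrix (Fin N → Fin n × (Fin L ⊕ Fin L)) (Fin N → Fin n × (Fin L ⊕ Fin L)) K)
    (h : ∀ b, β * slice (kroneckerPow (routed (R := K) (trow (tagTwist φ)) (tcol (tagTwist φ))) N) b =
      slice (kroneckerPow (routed (R := K) (trow (tagTwist φ)) (tcol (tagTwist φ))) N) b * γ') :
    (β, γ') ∈ LinearMap.range
      ((paramMap (K := K) (n := n) (L := L) (N := N)).prod (paramMap (K := K) (n := n))) := by
  obtain ⟨g, hg⟩ : ∃ g : ((Fin N → Bool) × (Fin N → Fin L) × (Fin N → Fin L)) → K,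
      ∀ u z : Fin N → Fin n × (Fin L ⊕ Fin L), paramMap (K := K) (n := n) g u z =
        if ∀ i, (u i).1 = (z i).1 ∧ (u i).2.isLeft = (z i).2.isLeft
          then β (base hn u) (base hn z) else 0 := by
    refine ⟨fun k => β (fun i => (⟨0, by omega⟩, mkCol (k.1 i) (k.2.1 i)))
      (fun i => (⟨0, by omega⟩, mkCol (k.1 i) (k.2.2 i))), fun u z => ?_⟩
    rw [paramMap_apply]
    by_cases hM : ∀ i, (u i).1 = (z i).1 ∧ (u i).2.isLeft = (z i).2.isLeft
    · rw [if_pos hM, if_pos hM]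
      dsimp only
      congr 1
      · funext i; simp only [base, mkCol_strip]
      · funext i; simp only [base, (hM i).2, mkCol_strip]
    · rw [if_neg hM, if_neg hM]
  refine ⟨g, Prod.ext ?_ ?_⟩
  · show paramMap g = β
    exact Matrix.ext fun u z => by rw [hg, (perm_entry hn hφ β γ' h u z).1]
  · show paramMap g = γ'
    exact Matrix.ext fun u z => by rw [hg, (perm_entry hn hφ β γ' h u z).2]

end Commutant

/-! ## The theorems -/

section Main

variable {K : Type*} [Field K] {n L N : ℕ}

/-- `𝔖_φ` is the routed star of the twist assignment `tagTwist φ`. [folklore] -/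
theorem permLeaf_eq_routed (n L : ℕ) (φ : Equiv.Perm (Fin n × Fin n)) :
    permLeaf K n L φ = routed (trow (tagTwist φ)) (tcol (tagTwist φ)) := by
  funext u b w
  obtain ⟨r, s⟩ := u
  obtain ⟨r', s'⟩ := w
  rcases s with l | l <;> rcases s' with l' | l' <;>
    simp [permLeaf, routed, trow, tcol, tagTwist, permStar, matMulTensor]

/-- The leaf-coordinate form: `cohLeaf^{⊠N} ⋭ permLeaf φ^{⊠N}` for `φ` not a product permutation
(`L ≥ 1`, `N ≥ 1`). [cite: BurgisserClausenShokrollahi1997, (15.19)] -/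
theorem leafPow_not_algDegeneratesTo_perm {φ : Equiv.Perm (Fin n × Fin n)} (hφ : ¬ IsProdPerm φ)
    (hL : 1 ≤ L) (hN : 1 ≤ N) :
    ¬ AlgDegeneratesTo (kroneckerPow (cohLeaf K n L) N) (kroneckerPow (permLeaf K n L φ) N) := by
  classical
  have hn : 2 ≤ n := two_le_of_not_isProdPerm hφ
  rw [cohLeaf_eq_routed, permLeaf_eq_routed]
  refine not_algDegeneratesTo_of_commutant
    (R₀ := (Fin N → Fin L ⊕ Fin L) × (Fin N → Fin L ⊕ Fin L))
    (kroneckerPow (routed (R := K) (fun (_ : Fin L ⊕ Fin L) (b : Fin n × Fin n) => b.1)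
      (fun _ b => b.2)) N)
    (kroneckerPow (routed (R := K) (trow (tagTwist φ)) (tcol (tagTwist φ))) N) unitMat unitMat
    (fun r b => unitMat_comm r b) (unitMat_linearIndependent hn)
    (LinearMap.range ((paramMap (K := K) (n := n) (L := L) (N := N)).prod paramMap)) ?_ ?_
  · intro β' γ' h
    exact perm_mem_range hn hφ β' γ' h
  · calc Module.finrank K
          (LinearMap.range ((paramMap (K := K) (n := n) (L := L) (N := N)).prod paramMap))
        ≤ Module.finrank K (((Fin N → Bool) × (Fin N → Fin L) × (Fin N → Fin L)) → K) :=
          LinearMap.finrank_range_le _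
      _ = Fintype.card ((Fin N → Bool) × (Fin N → Fin L) × (Fin N → Fin L)) :=
          Module.finrank_fintype_fun_eq_card K
      _ < Fintype.card ((Fin N → Fin L ⊕ Fin L) × (Fin N → Fin L ⊕ Fin L)) := card_param_lt hL hN

/-- **GENERIC twists: `𝔖_φ^{⊠N}` is not a degeneration of `⟨n,n,2L⟩^{⊠N}`** whenever `φ` is not a
product permutation (`L ≥ 1`, `N ≥ 1`, any field; `¬ (𝔖_φ^{⊠N} ⊴ ⟨n,n,2L⟩^{⊠N})` in the tree's
convention).  Kernel IV is the instance `φ = ᵀ`. [cite: BurgisserClausenShokrollahi1997, (15.19), (15.25)] -/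
theorem matMul_pow_not_algDegeneratesTo_permStar_pow {φ : Equiv.Perm (Fin n × Fin n)}
    (hφ : ¬ IsProdPerm φ) (hL : 1 ≤ L) (hN : 1 ≤ N) :
    ¬ AlgDegeneratesTo (kroneckerPow (matMulTensor K n n (L + L)) N)
      (kroneckerPow (permStar K n L φ) N) :=
  fun h => leafPow_not_algDegeneratesTo_perm hφ hL hN (algDegeneratesTo_permLeaf h)

/-- Single copy: `𝔖_φ` is not a degeneration of `⟨n,n,2L⟩` (`φ` not a product permutation, `L ≥ 1`).
[cite: BurgisserClausenShokrollahi1997, (15.19)] -/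
theorem matMul_not_algDegeneratesTo_permStar {φ : Equiv.Perm (Fin n × Fin n)}
    (hφ : ¬ IsProdPerm φ) (hL : 1 ≤ L) :
    ¬ AlgDegeneratesTo (matMulTensor K n n (L + L)) (permStar K n L φ) :=
  fun h => matMul_pow_not_algDegeneratesTo_permStar_pow hφ hL le_rfl (h.kroneckerPow 1)

/-! ### The special class: product twists are relabellings -/

/-- The index map of the relabelling `⟨n,n,L+L⟩ → 𝔖_{σ×τ}` on the `z`-side (`inr` rows through `σ⁻¹`)
or the `y`-side (`inr` rows through `τ⁻¹`). [folklore] -/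
def prodRelabel (n L : ℕ) (ρ : Fin n → Fin n) :
    (Fin n × Fin L) ⊕ (Fin n × Fin L) → Fin n × Fin (L + L)
  | Sum.inl a => (a.1, finSumFinEquiv (Sum.inl a.2))
  | Sum.inr a => (ρ a.1, finSumFinEquiv (Sum.inr a.2))

/-- **SPECIAL twists: `⟨n,n,L+L⟩ ≥ 𝔖_{σ×τ}`** (relabel the `inr` rows through `σ⁻¹`, `τ⁻¹`). [folklore] -/
theorem matMul_restrictsTo_permStar {φ : Equiv.Perm (Fin n × Fin n)} (hφ : IsProdPerm φ) :
    TensorRestrictsTo (matMulTensor K n n (L + L)) (permStar K n L φ) := by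
  classical
  obtain ⟨σ, τ, h⟩ := hφ
  have hσ : Function.Bijective σ :=
    Finite.injective_iff_bijective.mp (IsProdPerm.injective_fst h)
  have hτ : Function.Bijective τ :=
    Finite.injective_iff_bijective.mp (IsProdPerm.injective_snd h)
  set eσ := Equiv.ofBijective σ hσ with heσ
  set eτ := Equiv.ofBijective τ hτ with heτ
  have matMulTensor_apply' : ∀ (k m p : ℕ) (a : Fin k × Fin p) (b : Fin k × Fin m)
      (c : Fin m × Fin p), matMulTensor K k m p a b c =
        if a.1 = b.1 ∧ b.2 = c.1 ∧ a.2 = c.2 then 1 else 0 := fun _ _ _ _ _ _ => rfl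
  have e : (fun a b c => matMulTensor K n n (L + L) (prodRelabel n L eσ.symm a) b
      (prodRelabel n L eτ.symm c)) = permStar K n L φ := by
    funext a b c
    rcases a with a | a <;> rcases c with c | c
    · simp [prodRelabel, matMulTensor_apply', -finSumFinEquiv_apply_left,
        -finSumFinEquiv_apply_right]
    · simp [prodRelabel, matMulTensor_apply', -finSumFinEquiv_apply_left,
        -finSumFinEquiv_apply_right]
    · simp [prodRelabel, matMulTensor_apply', -finSumFinEquiv_apply_left,
        -finSumFinEquiv_apply_right]
    · simp only [prodRelabel, permStar_inr_inr, matMulTensor_apply', h,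
        EmbeddingLike.apply_eq_iff_eq, Sum.inr.injEq, Equiv.symm_apply_eq, Equiv.eq_symm_apply,
        heσ, heτ, Equiv.ofBijective_apply]
  rw [← e]
  exact tensorRestrictsTo_precomp _ _ _ _

/-- **SPECIAL twists: `𝔖_{σ×τ} ≥ ⟨n,n,L+L⟩`** (relabel the `inr` rows through `σ`, `τ`). [folklore] -/
theorem permStar_restrictsTo_matMul {φ : Equiv.Perm (Fin n × Fin n)} (hφ : IsProdPerm φ) :
    TensorRestrictsTo (permStar K n L φ) (matMulTensor K n n (L + L)) := by
  classical
  obtain ⟨σ, τ, h⟩ := hφ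
  have iσ := IsProdPerm.injective_fst h
  have iτ := IsProdPerm.injective_snd h
  have matMulTensor_apply' : ∀ (k m p : ℕ) (a : Fin k × Fin p) (b : Fin k × Fin m)
      (c : Fin m × Fin p), matMulTensor K k m p a b c =
        if a.1 = b.1 ∧ b.2 = c.1 ∧ a.2 = c.2 then 1 else 0 := fun _ _ _ _ _ _ => rfl
  -- inverse relabelling `Fin n × Fin (L+L) → (Fin n × Fin L) ⊕ (Fin n × Fin L)`
  set f : (Fin n → Fin n) → Fin n × Fin (L + L) → (Fin n × Fin L) ⊕ (Fin n × Fin L) :=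
    fun ρ p => Sum.elim (fun l => Sum.inl (p.1, l)) (fun l => Sum.inr (ρ p.1, l))
      (finSumFinEquiv.symm p.2) with hf
  have e : (fun a b c => permStar K n L φ (f σ a) b (f τ c)) = matMulTensor K n n (L + L) := by
    funext a b c
    obtain ⟨i, ν⟩ := a
    obtain ⟨j, ν'⟩ := c
    obtain ⟨x, rfl⟩ := finSumFinEquiv.surjective ν
    obtain ⟨x', rfl⟩ := finSumFinEquiv.surjective ν'
    rcases x with l | l <;> rcases x' with l' | l'
    · simp [hf, matMulTensor_apply', -finSumFinEquiv_apply_left, -finSumFinEquiv_apply_right]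
    · simp [hf, matMulTensor_apply', -finSumFinEquiv_apply_left, -finSumFinEquiv_apply_right]
    · simp [hf, matMulTensor_apply', -finSumFinEquiv_apply_left, -finSumFinEquiv_apply_right]
    · simp only [hf, permStar_inr_inr, matMulTensor_apply', h, Equiv.symm_apply_apply,
        Sum.elim_inr, EmbeddingLike.apply_eq_iff_eq, Sum.inr.injEq, iσ.eq_iff, iτ.eq_iff]
  rw [← e]
  exact tensorRestrictsTo_precomp _ _ _ _

/-- **THE DICHOTOMY.**  For every field, `L ≥ 1`, `N ≥ 1` and every permutation `φ` of the index
grid: `⟨n,n,2L⟩^{⊠N} ⊵ 𝔖_φ^{⊠N}` **iff** `φ` is a product permutation `(i,j) ↦ (σ i, τ j)` — and then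
already `⟨n,n,2L⟩ ≥ 𝔖_φ ≥ ⟨n,n,2L⟩`.  Special = invisible twist = relabelling; generic = rigidly
not below the coherent star at any finite level. [cite: BurgisserClausenShokrollahi1997, (15.19), (15.20), (15.25)] -/
theorem matMul_pow_algDegeneratesTo_permStar_pow_iff (φ : Equiv.Perm (Fin n × Fin n))
    (hL : 1 ≤ L) (hN : 1 ≤ N) :
    AlgDegeneratesTo (kroneckerPow (matMulTensor K n n (L + L)) N)
        (kroneckerPow (permStar K n L φ) N) ↔ IsProdPerm φ :=
  ⟨fun h => by_contra fun hφ => matMul_pow_not_algDegeneratesTo_permStar_pow hφ hL hN h,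
    fun hφ => AlgDegeneratesTo.kroneckerPow
      (TensorRestrictsTo.algDegeneratesTo (matMul_restrictsTo_permStar hφ)) N⟩

/-- The far-edge instance `L = 1`, single copy: `⟨n,n,2⟩ ⊵ 𝔖_φ` iff `φ` is a product permutation;
for `n = 2` this sorts the `24` twists into `4` special and `20` generic ones. [cite: BurgisserClausenShokrollahi1997, (15.19)] -/
theorem matMul_algDegeneratesTo_permStar_one_iff (φ : Equiv.Perm (Fin n × Fin n)) :
    AlgDegeneratesTo (matMulTensor K n n (1 + 1)) (permStar K n 1 φ) ↔ IsProdPerm φ :=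
  ⟨fun h => by_contra fun hφ => matMul_not_algDegeneratesTo_permStar hφ le_rfl h,
    fun hφ => TensorRestrictsTo.algDegeneratesTo (matMul_restrictsTo_permStar hφ)⟩

end Main

end Summit.MatrixMultiplication.MatrixMultiplication.Theorems.FarEdgeDescentTwistRigidity

end
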